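/-
Copyright (c) 2026 the pub-hodgecm-mathlib formalisation cell (harness21).  Prover seat hodgecm-mathlib-A-p19 (g19), topic T5 = P8
«(C♯)hol interior», node Cc (J-plc) brick (ii) (desk F0P2-plan (g8) «=» 20:14:40Z: report-first).  KERNEL: theorems + `abbrev`s with bodies.
-/
import Literature.NumberTheory.GelbartRogawski1991.DoubledWeilRepresentationArchVacuumUndoubling
import Literature.NumberTheory.Weil1964.ArchUnitaryWeilHalfCompactBlock
import Literature.NumberTheory.Automorphic.UnitaryGroupArchSection
import HarnessLib

/-!
# The ONE-PLACE element `((u at w, 1 elsewhere) ⊗ 1_W) ⊕ 1` of the doubled unitary group: place components, `η_t`, sign-block compactness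
# ([Kudla1994, §2]; [KonnoKonno2007, §3.1, Lem. 5.2]; [Folland1989, Prop. (4.39)])

Topic `NumberTheory/GelbartRogawski1991`; namespace `Literature.NumberTheory.GelbartRogawski1991.GRConstruction`.  KERNEL ONLY: proved theorems
and `abbrev`s with bodies (`placePair`, `archKPlace`, `placeDiagEntry`); 0 records, 0 `def … : Prop`, 0 named facts, 0 `sorry`.  Sibling of
`DoubledWeilRepresentationArchVacuumUndoubling` §1–§2, which treats the CENTRAL archimedean elements `k_t = ((t·1_V) ⊗ 1_W) ⊕ 1`; here the
element is `ũ = k_{w,u} := ((u at the complex place `w`, 1 at the other places) ⊗ 1_W) ⊕ 1` for an ARBITRARY `u ∈ U(σ_w diag dV)(ℂ)` — the element at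
which node Cc of the (C♯)hol interior ([Liu2021, Lem. D.2 (1)] at a DEFINITE place `w`; `F0/P2/T5a-TREE.md` §2b (J-plc)) reads the Weil action of
`U(V_w)` through the undoubled splitting `ι_χ = chiSplitting χ`.

* §1 `placePair w u = (adelicSingle w u) ⊗ 1_W ∈ G₁(𝔸)` and `archKPlace w u = (inlG (placePair w u))_∞ ∈ H(L⁺ ⊗ ℝ)`; the finite part of
  `inlG (placePair w u)` is trivial (`finPart_inlG_adelicInl_archToAdelic`, for ANY archimedean `a ∈ U(diag dV)(L ⊗ ℝ)`), so
  `archToAdelic (archKPlace w u) = inlG (placePair w u)` (`archToAdelic_archKPlace`); the place components: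
  **`coe_archAt_archKPlace`** — at the real place `v`, the matrix of `(archKPlace w u)_{w(v)}` is
  `reindex e₂ (fromBlocks (reindex e ((u)_{w(v)} ⊗ 1_M)) 0 0 1)` with `(u)_{w(v)} = u` if `w(v) = w` and `1` otherwise
  (`coe_archAt_archSingle`).
* §2 **`coe_etaD_archKPlace`** — `η_t(archKPlace w u) = ((det u)^M)^{(t_w + 1)/2}` (only the place under `w` contributes; ★ `coe_archDetZPow`,
  `det (A ⊗ 1_M) = (det A)^M`).
* §3 **`exists_archUFormPi_archKPlace_eq_kV`** — if `σ_v(d_V)` has CONSTANT SIGN at the real place `v(w)` under `w` (the form is DEFINITE at `w`),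
  every place component of `archKPlace w u` is sign-separated, hence `archUFormPi (archKPlace w u) v = kV (a_v, b_v)` for all `v` (★ brick (i)
  `exists_archUFormPi_eq_kV_of_sign_separated`), and **`exists_proj_sectionD_archKPlace`**: Folland's section at `archKPlace w u` has a unitary
  phase map (★ `exists_proj_archWeilSectionS_eq_realifySp`) — the hypothesis `hu` of ★ `omega_archHalfOf_gaussian_tmul`.

HONEST SCOPE.  Bookkeeping only; the vacuum coefficient `vac (sectionD (archKPlace w u))` (brick (iii)) and the Gaussian eigen-statement of the undoubled
splitting (J-plc-G) are the sequel.  HC_CM is NOT proved here or anywhere in the tree.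

References: [Kudla1994] S. Kudla, Israel J. Math. 87 (1994), §2; [KonnoKonno2007] Kyushu J. Math. 61 (2007), §3.1, Lemma 5.2; [Folland1989] §4.2
Prop. (4.39); [BorelJacquet1979] PSPM 33.1 §4.1 (`G(𝔸) = G_∞ × G(𝔸_f)`, `G_∞ = ∏_v G(F_v)`).
-/

set_option autoImplicit false

noncomputable section

open scoped Classical
open scoped Matrix Kronecker
open NumberField NumberField.InfinitePlace NumberField.mixedEmbedding IsDedekindDomain
open Literature.NumberTheory.Automorphic Literature.NumberTheory.Automorphic.UnitaryGroup
open Literature.NumberTheory.Weil1964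

namespace Literature.NumberTheory.GelbartRogawski1991.GRConstruction

open UnitaryDualPair
open Literature.NumberTheory.GelbartRogawski1991.UnitaryDualPair.LocalSplitting

variable (L : Type) [Field L] [NumberField L] [IsCMField L]

variable {N M n : ℕ} (e : Fin N × Fin M ≃ Fin n)
  (dV : Fin N → L) (hdV : ∀ i, IsCMField.complexConj L (dV i) = dV i) (hdV0 : ∀ i, dV i ≠ 0)
  (dW : Fin M → L) (hdW : ∀ i, IsCMField.complexConj L (dW i) = dW i) (hdW0 : ∀ i, dW i ≠ 0)

/-! ## §1 The element and its place components -/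

section Element

/-- **the finite part of `((a, 1_f) ⊗ 1_W) ⊕ 1` is trivial** for every archimedean `a ∈ U(diag dV)(L ⊗ ℝ)` (entrywise: the adelic matrix of
`archToAdelic a` has finite components `δ_ij`, and `inlG ∘ adelicInl` is built from reindexing, a Kronecker product with `1_W` and a block sum with `1`).
[cite: BorelJacquet1979, §4.1] -/
theorem finPart_inlG_adelicInl_archToAdelic
    (a : UnitaryGroup.arch (Fp L) L (IsCMField.complexConj L) N (Matrix.diagonal dV)) :
    UnitaryGroup.finPart (Fp L) L (IsCMField.complexConj L) (n + n) (hermD L e dV hdV dW hdW)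
        (inlG L e dV hdV dW hdW (UnitaryGroup.adelicInl (Fp L) L (IsCMField.complexConj L) N M (Matrix.diagonal dV) (Matrix.diagonal dW)
          (UnitaryGroup.archToAdelic (Fp L) L (IsCMField.complexConj L) N (Matrix.diagonal dV) a))) = 1 := by
  apply Subtype.ext
  refine Matrix.GeneralLinearGroup.ext fun i j => ?_
  change ((((inlG L e dV hdV dW hdW (UnitaryGroup.adelicInl (Fp L) L (IsCMField.complexConj L) N M (Matrix.diagonal dV) (Matrix.diagonal dW)
      (UnitaryGroup.archToAdelic (Fp L) L (IsCMField.complexConj L) N (Matrix.diagonal dV) a)) : HA L e dV hdV dW hdW) :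
      GL (Fin (n + n)) (AdeleRing (𝓞 L) L)) : Matrix (Fin (n + n)) (Fin (n + n)) (AdeleRing (𝓞 L) L)) i j).2 =
    ((1 : GL (Fin (n + n)) (FiniteAdeleRing (𝓞 L) L)) : Matrix (Fin (n + n)) (Fin (n + n)) (FiniteAdeleRing (𝓞 L) L)) i j
  rw [coe_inlG, UnitaryGroup.coe_reindexGL, UnitaryGroup.coe_blockDiagGL, UnitaryGroup.coe_reindexGL, UnitaryGroup.coe_adelicInl,
    Matrix.reindex_apply, Matrix.submatrix_apply]
  have hidx : ∀ {x y : Fin n ⊕ Fin n}, (e₂ (n := n)).symm i = x → (e₂ (n := n)).symm j = y → (i = j ↔ x = y) :=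
    fun {x y} hx hy => ⟨fun h => by subst h; exact hx.symm.trans hy, fun h => (e₂ (n := n)).symm.injective (hx.trans (h ▸ hy.symm))⟩
  have hR : ((1 : GL (Fin (n + n)) (FiniteAdeleRing (𝓞 L) L)) : Matrix (Fin (n + n)) (Fin (n + n)) (FiniteAdeleRing (𝓞 L) L)) i j =
      if i = j then 1 else 0 := by rw [Units.val_one, Matrix.one_apply]
  rw [hR]
  rcases h₁ : (e₂ (n := n)).symm i with i₁ | i₂ <;> rcases h₂ : (e₂ (n := n)).symm j with j₁ | j₂
  · rw [Matrix.fromBlocks_apply₁₁, Matrix.reindex_apply, Matrix.submatrix_apply, Matrix.kroneckerMap_apply, Matrix.one_apply]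
    by_cases hj2 : (e.symm i₁).2 = (e.symm j₁).2
    · rw [if_pos hj2, mul_one, UnitaryGroup.coe_archToAdelic_apply, Matrix.one_apply]
      show (if (e.symm i₁).1 = (e.symm j₁).1 then (1 : FiniteAdeleRing (𝓞 L) L) else 0) = _
      by_cases hij : i = j
      · have hx := (hidx h₁ h₂).1 hij
        cases hx
        rw [if_pos rfl, if_pos hij]
      · rw [if_neg hij, if_neg]
        intro h1
        exact hij ((hidx h₁ h₂).2 (congrArg Sum.inl (e.symm.injective (Prod.ext h1 hj2))))
    · rw [if_neg hj2, mul_zero, if_neg]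
      · rfl
      · intro hij
        have hx := (hidx h₁ h₂).1 hij
        cases hx
        exact hj2 rfl
  · rw [Matrix.fromBlocks_apply₁₂, Matrix.zero_apply, if_neg (fun hij => by have hx := (hidx h₁ h₂).1 hij; cases hx)]
    rfl
  · rw [Matrix.fromBlocks_apply₂₁, Matrix.zero_apply, if_neg (fun hij => by have hx := (hidx h₁ h₂).1 hij; cases hx)]
    rfl
  · rw [Matrix.fromBlocks_apply₂₂, Units.val_one, Matrix.one_apply]
    by_cases hij : i = j
    · have hx := (hidx h₁ h₂).1 hij
      cases hx
      rw [if_pos rfl, if_pos hij]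
      rfl
    · rw [if_neg hij, if_neg (fun h => hij ((hidx h₁ h₂).2 (congrArg Sum.inr h)))]
      rfl

variable (v₀ : {v : InfinitePlace (Fp L) // v.IsReal})

/-- **the pair-group element `(u at w(v₀), 1 elsewhere) ⊗ 1_W ∈ G₁(𝔸)`** of a place component `u ∈ U(σ_{w(v₀)} diag dV)(ℂ)` (`adelicInl ∘ adelicSingle`).
[cite: BorelJacquet1979, §4.1] -/
abbrev placePair (u : UnitaryGroup.archLocal L N (Matrix.diagonal dV) (cmPlaceOver L v₀)) :
    UnitaryGroup.adelicPair (Fp L) L (IsCMField.complexConj L) N M (Matrix.diagonal dV) (Matrix.diagonal dW) :=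
  UnitaryGroup.adelicInl (Fp L) L (IsCMField.complexConj L) N M (Matrix.diagonal dV) (Matrix.diagonal dW)
    (UnitaryGroup.adelicSingle (Fp L) L (IsCMField.complexConj L) N (Matrix.diagonal dV) (IsCMField.complexConj_ne_one L)
      (complexConj_smul_infinitePlace L) (cmPlaceOver L v₀) u)

/-- **the archimedean avatar `k_{v₀,u} := (((u at w(v₀)) ⊗ 1_W) ⊕ 1)_∞ ∈ H(L⁺ ⊗ ℝ)`** (the `archPart` of `inlG (placePair v₀ u)`).
[cite: BorelJacquet1979, §4.1] [cite: Kudla1994, §2 (doubled space, Siegel parabolic)] -/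
abbrev archKPlace (u : UnitaryGroup.archLocal L N (Matrix.diagonal dV) (cmPlaceOver L v₀)) :
    UnitaryGroup.arch (Fp L) L (IsCMField.complexConj L) (n + n) (hermD L e dV hdV dW hdW) :=
  UnitaryGroup.archPart (Fp L) L (IsCMField.complexConj L) (n + n) (hermD L e dV hdV dW hdW) (inlG L e dV hdV dW hdW (placePair L dV dW v₀ u))

/-- **`(k_{v₀,u}, 1) = ((u at w(v₀)) ⊗ 1_W) ⊕ 1` in `H(𝔸)`** (the finite part is trivial). [cite: BorelJacquet1979, §4.1] -/
theorem archToAdelic_archKPlace (u : UnitaryGroup.archLocal L N (Matrix.diagonal dV) (cmPlaceOver L v₀)) :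
    UnitaryGroup.archToAdelic (Fp L) L (IsCMField.complexConj L) (n + n) (hermD L e dV hdV dW hdW) (archKPlace L e dV hdV dW hdW v₀ u) =
      inlG L e dV hdV dW hdW (placePair L dV dW v₀ u) := by
  have h := UnitaryGroup.archToAdelic_mul_finAdelicToAdelic (Fp L) L (IsCMField.complexConj L) (n + n) (hermD L e dV hdV dW hdW)
    (inlG L e dV hdV dW hdW (placePair L dV dW v₀ u))
  rw [placePair, UnitaryGroup.adelicSingle_apply, finPart_inlG_adelicInl_archToAdelic, map_one, mul_one] at h
  exact h

/-- **the place components of `k_{v₀,u}`**: at the real place `v`, the matrix of `(k_{v₀,u})_{w(v)}` is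
`reindex e₂ (fromBlocks (reindex e ((u)_{w(v)} ⊗ 1_W)) 0 0 1)`, where `(u)_{w(v)}` is the matrix of `archAt (w(v)) (archSingle (w(v₀)) u)` — `u` for
`v = v₀`, `1` otherwise (★ `archAt_archSingle_self ∕ _of_ne`). [cite: BorelJacquet1979, §4.1] [cite: Kudla1994, §2 (doubled space, Siegel parabolic)] -/
theorem coe_archAt_archKPlace (u : UnitaryGroup.archLocal L N (Matrix.diagonal dV) (cmPlaceOver L v₀)) (v : {v : InfinitePlace (Fp L) // v.IsReal}) :
    (((UnitaryGroup.archAt (Fp L) L (IsCMField.complexConj L) (n + n) (hermD L e dV hdV dW hdW) (cmPlaceOver L v) (cmPlaceOver_smul L v)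
        (IsCMField.complexConj_ne_one L) (archKPlace L e dV hdV dW hdW v₀ u) :
        UnitaryGroup.archLocal L (n + n) (hermD L e dV hdV dW hdW) (cmPlaceOver L v)) : GL (Fin (n + n)) ℂ) : Matrix (Fin (n + n)) (Fin (n + n)) ℂ) =
      Matrix.reindex (e₂ (n := n)) (e₂ (n := n))
        (Matrix.fromBlocks
          (Matrix.reindex e e
            ((((UnitaryGroup.archAt (Fp L) L (IsCMField.complexConj L) N (Matrix.diagonal dV) (cmPlaceOver L v) (cmPlaceOver_smul L v)
                (IsCMField.complexConj_ne_one L)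
                (UnitaryGroup.archSingle (Fp L) L (IsCMField.complexConj L) N (Matrix.diagonal dV) (IsCMField.complexConj_ne_one L)
                  (complexConj_smul_infinitePlace L) (cmPlaceOver L v₀) u) :
                UnitaryGroup.archLocal L N (Matrix.diagonal dV) (cmPlaceOver L v)) : GL (Fin N) ℂ) : Matrix (Fin N) (Fin N) ℂ) ⊗ₖ
              (1 : Matrix (Fin M) (Fin M) ℂ)))
          0 0 1) := by
  rw [← UnitaryGroup.map_placeEval_coe_archToAdelic, archToAdelic_archKPlace,
    ← UnitaryGroup.map_placeEval_coe_archToAdelic (Fp L) L (IsCMField.complexConj L) N (Matrix.diagonal dV) (cmPlaceOver L v)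
      (cmPlaceOver_smul L v) (IsCMField.complexConj_ne_one L)]
  change ((((inlG L e dV hdV dW hdW (placePair L dV dW v₀ u) : HA L e dV hdV dW hdW) :
      GL (Fin (n + n)) (AdeleRing (𝓞 L) L)) : Matrix (Fin (n + n)) (Fin (n + n)) (AdeleRing (𝓞 L) L))).map _ = _
  rw [coe_inlG, UnitaryGroup.coe_reindexGL, UnitaryGroup.coe_blockDiagGL, UnitaryGroup.coe_reindexGL, UnitaryGroup.coe_adelicInl,
    Units.val_one]
  ext i j
  simp only [Matrix.map_apply, Matrix.reindex_apply, Matrix.submatrix_apply]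
  rcases (e₂ (n := n)).symm i with a | a <;> rcases (e₂ (n := n)).symm j with b | b
  · simp only [Matrix.fromBlocks_apply₁₁, Matrix.submatrix_apply, Matrix.kroneckerMap_apply, Matrix.map_apply, Matrix.one_apply,
      UnitaryGroup.adelicSingle_apply]
    split_ifs <;> simp
  · simp only [Matrix.fromBlocks_apply₁₂, Matrix.zero_apply, map_zero]
  · simp only [Matrix.fromBlocks_apply₂₁, Matrix.zero_apply, map_zero]
  · simp only [Matrix.fromBlocks_apply₂₂, Matrix.one_apply, apply_ite, map_one, map_zero]
    split_ifs <;> rfl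

end Element

/-! ## §2 The explicit twist character at `k_{v₀,u}`: `η_t(k_{v₀,u}) = ((det u)^M)^{(t_{w(v₀)} + 1)/2}` -/

section Eta

variable (v₀ : {v : InfinitePlace (Fp L) // v.IsReal})

/-- the determinant of the place component of `k_{v₀,u}` at `v`: `(det u)^M` at `v = v₀`, `1` elsewhere.
[cite: KonnoKonno2007, §3.1 (3.1)] -/
theorem det_coe_archAt_archKPlace (u : UnitaryGroup.archLocal L N (Matrix.diagonal dV) (cmPlaceOver L v₀))
    (v : {v : InfinitePlace (Fp L) // v.IsReal}) :
    (((UnitaryGroup.archAt (Fp L) L (IsCMField.complexConj L) (n + n) (hermD L e dV hdV dW hdW) (cmPlaceOver L v) (cmPlaceOver_smul L v)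
        (IsCMField.complexConj_ne_one L) (archKPlace L e dV hdV dW hdW v₀ u) :
        UnitaryGroup.archLocal L (n + n) (hermD L e dV hdV dW hdW) (cmPlaceOver L v)) : GL (Fin (n + n)) ℂ) : Matrix (Fin (n + n)) (Fin (n + n)) ℂ).det =
      if v = v₀ then ((((u : UnitaryGroup.archLocal L N (Matrix.diagonal dV) (cmPlaceOver L v₀)) : GL (Fin N) ℂ) : Matrix (Fin N) (Fin N) ℂ).det) ^ M
      else 1 := by
  rw [coe_archAt_archKPlace, Matrix.det_reindex_self, Matrix.det_fromBlocks_zero₂₁, Matrix.det_one, mul_one, Matrix.det_reindex_self,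
    Matrix.det_kronecker, Matrix.det_one, one_pow, mul_one, Fintype.card_fin]
  by_cases hv : v = v₀
  · subst hv
    rw [if_pos rfl]
    erw [UnitaryGroup.archAt_archSingle_self (Fp L) L (IsCMField.complexConj L) N (Matrix.diagonal dV) (IsCMField.complexConj_ne_one L)
      (complexConj_smul_infinitePlace L) (cmPlaceOver L v) u]
  · have hne : cmPlaceOver L v ≠ cmPlaceOver L v₀ := fun h => hv (Subtype.ext (by
      rw [← cmPlaceOver_comap L v, ← cmPlaceOver_comap L v₀, h]))
    rw [if_neg hv]
    erw [UnitaryGroup.archAt_archSingle_of_ne (Fp L) L (IsCMField.complexConj L) N (Matrix.diagonal dV)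
      (IsCMField.complexConj_ne_one L) (complexConj_smul_infinitePlace L) (cmPlaceOver L v₀) hne u]
    simp

/-- **`η_t(k_{v₀,u}) = ((det u)^M)^{(t_{w(v₀)} + 1)/2}`** (★ `coe_archDetZPow`: only the place `v₀` contributes).
[cite: Paul1998, §1.2 (1.2.1)–(1.2.2) p. 389 L11–29] [cite: KonnoKonno2007, Lem. 5.2] -/
theorem coe_etaD_archKPlace (τ : InfinitePlace L → ℤ) (u : UnitaryGroup.archLocal L N (Matrix.diagonal dV) (cmPlaceOver L v₀)) :
    ((etaD L e dV hdV dW hdW τ (archKPlace L e dV hdV dW hdW v₀ u) : ℂˣ) : ℂ) =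
      (((((u : UnitaryGroup.archLocal L N (Matrix.diagonal dV) (cmPlaceOver L v₀)) : GL (Fin N) ℂ) : Matrix (Fin N) (Fin N) ℂ).det) ^ M) ^
        ((τ (cmPlaceOver L v₀).1 + 1) / 2) := by
  rw [etaD, UnitaryGroup.coe_archDetZPow]
  rw [Finset.prod_eq_single v₀]
  · rw [det_coe_archAt_archKPlace, if_pos rfl]
  · intro v _ hv
    rw [det_coe_archAt_archKPlace, if_neg hv, one_zpow]
  · intro h; exact absurd (Finset.mem_univ v₀) h

end Eta

/-! ## §3 Sign-block compactness of `k_{v₀,u}` when the pair form is DEFINITE at `v₀` -/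

section Compact

open Literature.RepresentationTheory.KonnoKonno2007 Literature.RepresentationTheory.KonnoKonno2007.RealDualPair
open Literature.Analysis.SegalBargmann

variable (v₀ : {v : InfinitePlace (Fp L) // v.IsReal})

/-- **every place component of `k_{v₀,u}` is SIGN-SEPARATED** when the pair sign vector is constant at `v₀` (the pair form `diag dV ⊗ diag dW` is
DEFINITE at `w(v₀)`): at `v = v₀` the component is `(u ⊗ 1_W) ⊕ 1` with all of `𝕍` in one sign block and all of `−𝕍` in the other; at `v ≠ v₀` it is
`1`.  (The hypothesis `hsep` of ★ `exists_archUFormPi_eq_kV_of_sign_separated` ∕ `det_of_archUFormPi_eq_kV_of_sign_separated` for `g = k_{v₀,u}`.)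
[cite: Folland1989, §4.2 Prop. (4.39)] [cite: KonnoKonno2007, §3.1] -/
theorem archAt_archKPlace_sign_separated (u : UnitaryGroup.archLocal L N (Matrix.diagonal dV) (cmPlaceOver L v₀))
    (hdef : ∀ k k' : Fin n, (0 < signVec (cmPlaceOver L) (cmGramEntry L e dV hdV dW hdW) (imagUnit L) v₀ k ↔
      0 < signVec (cmPlaceOver L) (cmGramEntry L e dV hdV dW hdW) (imagUnit L) v₀ k'))
    (v : {v : InfinitePlace (Fp L) // v.IsReal}) :
    ∀ k k' : Fin (n + n), 0 < signVec (cmPlaceOver L) (entryD L e dV hdV dW hdW) (imagUnit L) v k →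
      ¬ 0 < signVec (cmPlaceOver L) (entryD L e dV hdV dW hdW) (imagUnit L) v k' →
      (((UnitaryGroup.archAt (Fp L) L (IsCMField.complexConj L) (n + n) (hermD L e dV hdV dW hdW) (cmPlaceOver L v) (cmPlaceOver_smul L v)
          (IsCMField.complexConj_ne_one L) (archKPlace L e dV hdV dW hdW v₀ u) :
          UnitaryGroup.archLocal L (n + n) (hermD L e dV hdV dW hdW) (cmPlaceOver L v)) : GL (Fin (n + n)) ℂ) :
          Matrix (Fin (n + n)) (Fin (n + n)) ℂ) k k' = 0 ∧
      (((UnitaryGroup.archAt (Fp L) L (IsCMField.complexConj L) (n + n) (hermD L e dV hdV dW hdW) (cmPlaceOver L v) (cmPlaceOver_smul L v)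
          (IsCMField.complexConj_ne_one L) (archKPlace L e dV hdV dW hdW v₀ u) :
          UnitaryGroup.archLocal L (n + n) (hermD L e dV hdV dW hdW) (cmPlaceOver L v)) : GL (Fin (n + n)) ℂ) :
          Matrix (Fin (n + n)) (Fin (n + n)) ℂ) k' k = 0 := by
  intro k k' hk hk'
  have hkk' : k ≠ k' := fun h => hk' (h ▸ hk)
  rw [coe_archAt_archKPlace]
  obtain ⟨x, rfl⟩ := (e₂ (n := n)).surjective k
  obtain ⟨y, rfl⟩ := (e₂ (n := n)).surjective k'
  simp only [Matrix.reindex_apply, Matrix.submatrix_apply, Equiv.symm_apply_apply]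
  rcases x with a | a <;> rcases y with b | b
  · -- both in the first copy: impossible at `v₀` by definiteness; at `v ≠ v₀` the block is `1 ⊗ 1`
    rw [signVec_doubled_inl] at hk hk'
    by_cases hv : v = v₀
    · subst hv; exact absurd ((hdef a b).1 hk) hk'
    · have hne : cmPlaceOver L v ≠ cmPlaceOver L v₀ := fun h => hv (Subtype.ext (by
        rw [← cmPlaceOver_comap L v, ← cmPlaceOver_comap L v₀, h]))
      have hab : a ≠ b := fun h => hkk' (by rw [h])
      have h1 := UnitaryGroup.archAt_archSingle_of_ne (Fp L) L (IsCMField.complexConj L) N (Matrix.diagonal dV)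
        (IsCMField.complexConj_ne_one L) (complexConj_smul_infinitePlace L) (cmPlaceOver L v₀) hne u
      erw [h1]
      simp only [Matrix.fromBlocks_apply₁₁, Matrix.submatrix_apply, OneMemClass.coe_one, Units.val_one,
        Matrix.one_kronecker_one, Matrix.one_apply, e.symm.injective.eq_iff, hab, hab.symm, if_false, and_self]
  · simp only [Matrix.fromBlocks_apply₁₂, Matrix.fromBlocks_apply₂₁, Matrix.zero_apply, and_self]
  · simp only [Matrix.fromBlocks_apply₁₂, Matrix.fromBlocks_apply₂₁, Matrix.zero_apply, and_self]
  · have hab : a ≠ b := fun h => hkk' (by rw [h])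
    simp only [Matrix.fromBlocks_apply₂₂, Matrix.one_apply, hab, hab.symm, if_false, and_self]

include hdV0 hdW0 in
/-- **`archUFormPi (k_{v₀,u}) v = kV (a_v, b_v)` at every real place `v`** when the pair form is definite at `w(v₀)` (★ brick (i)
`exists_archUFormPi_eq_kV_of_sign_separated` + `archAt_archKPlace_sign_separated`). [cite: Folland1989, §4.2 Prop. (4.39)] [cite: KonnoKonno2007, §3.1] -/
theorem exists_archUFormPi_archKPlace_eq_kV (u : UnitaryGroup.archLocal L N (Matrix.diagonal dV) (cmPlaceOver L v₀))
    (hdef : ∀ k k' : Fin n, (0 < signVec (cmPlaceOver L) (cmGramEntry L e dV hdV dW hdW) (imagUnit L) v₀ k ↔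
      0 < signVec (cmPlaceOver L) (cmGramEntry L e dV hdV dW hdW) (imagUnit L) v₀ k'))
    (v : {v : InfinitePlace (Fp L) // v.IsReal}) :
    ∃ k : Matrix.unitaryGroup (PosIdx (signVec (cmPlaceOver L) (entryD L e dV hdV dW hdW) (imagUnit L) v)) ℂ ×
        Matrix.unitaryGroup (NegIdx (signVec (cmPlaceOver L) (entryD L e dV hdV dW hdW) (imagUnit L) v)) ℂ,
      archUFormPi L (IsCMField.complexConj L) (n + n) (IsCMField.complexConj_ne_one L) (cmPlaceOver L) (cmPlaceOver_smul L)
          (cmPlaceOver_comap L) (entryD L e dV hdV dW hdW) (gramD_gram_realDiagonal_entry_ne_zero L e dV hdV dW hdW hdV0 hdW0)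
          (gramD_eq_diagonal_cm L e dV hdV dW hdW) (J := hermD L e dV hdV dW hdW) rfl (complexConj_imagUnit L) (imagUnit_ne_zero L)
          (archKPlace L e dV hdV dW hdW v₀ u) v =
        UForm.kV _ _ k :=
  (exists_archUFormPi_eq_kV_of_sign_separated L (IsCMField.complexConj L) (n + n) (IsCMField.complexConj_ne_one L)
    (cmPlaceOver L) (cmPlaceOver_smul L) (cmPlaceOver_comap L) (entryD L e dV hdV dW hdW)
    (gramD_gram_realDiagonal_entry_ne_zero L e dV hdV dW hdW hdV0 hdW0) (gramD_eq_diagonal_cm L e dV hdV dW hdW)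
    (J := hermD L e dV hdV dW hdW) rfl
    (complexConj_imagUnit L) (imagUnit_ne_zero L) (archKPlace L e dV hdV dW hdW v₀ u) v
    (archAt_archKPlace_sign_separated L e dV hdV dW hdW v₀ u hdef v)).imp fun _ hk => hk.1

include hdV0 hdW0 in
/-- **the phase map of Folland's section at `k_{v₀,u}` is a realified unitary** (definite `v₀`) — the hypothesis `hu` of ★
`omega_archHalfOf_gaussian_tmul` for the one-place element. [cite: Folland1989, §4.2 Prop. (4.39)] -/
theorem exists_proj_sectionD_archKPlace (u : UnitaryGroup.archLocal L N (Matrix.diagonal dV) (cmPlaceOver L v₀))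
    (hdef : ∀ k k' : Fin n, (0 < signVec (cmPlaceOver L) (cmGramEntry L e dV hdV dW hdW) (imagUnit L) v₀ k ↔
      0 < signVec (cmPlaceOver L) (cmGramEntry L e dV hdV dW hdW) (imagUnit L) v₀ k')) :
    ∃ U : Matrix.unitaryGroup (Fin (n + n) × {v : InfinitePlace (Fp L) // v.IsReal}) ℂ,
      MpS.proj (sectionD L e dV hdV hdV0 dW hdW hdW0 (archKPlace L e dV hdV dW hdW v₀ u)) = realifySp _ U := by
  choose a ha using exists_archUFormPi_archKPlace_eq_kV L e dV hdV hdV0 dW hdW hdW0 v₀ u hdef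
  exact exists_proj_archWeilSectionS_eq_realifySp L (IsCMField.complexConj L) (n + n) (IsCMField.complexConj_ne_one L) (cmPlaceOver L)
    (cmPlaceOver_smul L) (cmPlaceOver_comap L) (entryD L e dV hdV dW hdW)
    (gramD_gram_realDiagonal_entry_ne_zero L e dV hdV dW hdW hdV0 hdW0) (gramD_eq_diagonal_cm L e dV hdV dW hdW)
    (J := hermD L e dV hdV dW hdW) rfl
    (complexConj_imagUnit L) (imagUnit_ne_zero L) (archKPlace L e dV hdV dW hdW v₀ u) (fun v => (a v).1) (fun v => (a v).2)
    (fun v => ha v)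

end Compact

end Literature.NumberTheory.GelbartRogawski1991.GRConstruction

end
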